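import Summits.QuantumFields.YangMills.Theorems.SwapVirialDeficitQuantitativeLaplaceFibred
import Summits.QuantumFields.YangMills.Theorems.SwapVirialDeficitQuantitativeLaplaceCubic
import HarnessLib

/-!
# The fibred (Morse–Bott) Laplace layer made CORE-AGNOSTIC, and its instance with the cubic `O(β^{−1/2})` core
# (free-hands support of ⟨stmt-QuantumFields-24197⟩ `SwapVirialDeficit.SwapGluedStiffness`; generic, sequel of ✓`…QuantitativeLaplaceFibred` and
# ✓`…QuantitativeLaplaceCubic`)

* ★★ `laplaceMethod_fibred_of_fibrewise` — the ABSTRACT fibred step: `(M,ν)` s-finite, `V` the `m`-dimensional transversal, `A p` symmetric uniformly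
  `λ`-coercive and jointly measurable, a jointly measurable tube integrand `F : M × V → ℝ` with `|F(p,y)| ≤ C·w₀(p)` on the ball and ANY uniform relative fibre
  bound `|∫_{B̄_R} F(p,·) − w₀(p)𝔊_p(β)| ≤ ε·w₀(p)𝔊_p(β)` (`𝔊_p = (2π/β)^{m/2}/√det A p`, `0 ≤ w₀ ∈ L¹(ν)`, any real `ε`) ⟹ integrability on the tube, of the main term, and
  `|∫_{M×B̄_R} F − (2π/β)^{m/2}∫ w₀/√det A p dν| ≤ ε·(main)`.  So EVERY Euclidean core (✓`laplaceMethod_quantitative_of_eqOn`: `ε = K/β`;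
  ✓`laplaceMethod_quantitative_cubic_of_eqOn`: `ε = K₃/√β + K₂/β`; future ones) plugs into the same Morse–Bott layer.
* ★★★ `laplaceMethod_quantitative_fibred_cubic` — the instance with the CUBIC core: fibre data `f = ½⟪A p y,y⟫ + ρ`, `w = w₀(p)(1 + η)` on the ball with ONLY
  `|ρ| ≤ A₃‖y‖³`, `|η| ≤ D‖y‖` (jointly measurable, no parity), smallness `A₃R ≤ λ/(8(m+8))`, `DR ≤ 1` ⟹ the fibred two-sided bound with
  `ε = (16A₃(m+8)/λ + 256A₃(m+8)²/λ² + D + 8D(m+8)/λ)/√β + 16(m+8)/(λR²β)` — ORDER-3 fibre jets suffice.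

HONEST FRAMING: generic real analysis; width 0 by itself toward any lattice statement; ⟨24197⟩, ⟨24196⟩, ⟨24194⟩, ⟨24497⟩ and every rung ∕ summit statement stay OPEN;
own crux ⟨22884⟩ OPEN (blocked-on ⟨19935⟩); the Yang–Mills mass gap is NOT proved; no summit is proved by a line.  Width seat ym-line-sfw-p2-w2 g58 (cell ym-idea-1,
free hands), `--supports stmt-QuantumFields-24197`.  THEOREMS ONLY (0 `def`, 0 `sorry`), standard axioms.

## References
* M. Hasenpflug, D. Rudolf, B. Sprungk, Ann. Appl. Probab. 34 (2024), App. 4.1 Thm 16 ∕ Remark 17. [HasenpflugRudolfSprungk2024]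
* K. W. Breitung, *Asymptotic Approximations for Probability Integrals*, LNM 1592 (1994), Thm 41 p. 56. [Breitung1994]
-/

set_option autoImplicit false

noncomputable section

open _root_.MeasureTheory _root_.Filter _root_.Set _root_.Module _root_.Metric
open scoped _root_.Topology _root_.Real _root_.InnerProductSpace

namespace Summit.QuantumFields.YangMills.Theorems.QuantitativeLaplace

open Literature.Analysis.Asymptotics

variable {M : Type*} [MeasurableSpace M] {ν : Measure M} [SFinite ν]
variable {V : Type*} [NormedAddCommGroup V] [InnerProductSpace ℝ V] [FiniteDimensional ℝ V]
  [MeasurableSpace V] [BorelSpace V]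

/-! ## §1 The abstract fibred step: integrate a uniform relative fibre bound -/

/-- ★★ **Core-agnostic fibred Laplace step.**  If the tube integrand `F` is jointly measurable with `|F(p,y)| ≤ C·w₀(p)` on `‖y‖ ≤ R` (`0 ≤ w₀ ∈ L¹(ν)`),
`A p` is a jointly measurable uniformly coercive symmetric field, and on EVERY fibre `|∫_{B̄_R} F(p,·) − w₀(p)𝔊_p| ≤ ε·w₀(p)𝔊_p`, then `F` is
integrable on `M × B̄_R`, the main term is integrable, and `|∫_{M×B̄_R} F − (2π/β)^{m/2}∫_M w₀/√det(A p) dν| ≤ ε·(2π/β)^{m/2}∫_M w₀/√det(A p) dν`.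
[cite: HasenpflugRudolfSprungk2024, App. 4.1 Thm 16] -/
theorem laplaceMethod_fibred_of_fibrewise {A : M → V →ₗ[ℝ] V} (hA : ∀ p, (A p).IsSymmetric) {lam : ℝ} (hlam : 0 < lam)
    (hcoer : ∀ p (y : V), lam * ‖y‖ ^ 2 ≤ ⟪A p y, y⟫_ℝ)
    (hAm : Measurable fun z : M × V => ⟪A z.1 z.2, z.2⟫_ℝ)
    {R β C ε : ℝ} (hβ : 0 < β) (hC : 0 ≤ C)
    {F : M × V → ℝ} (hFm : Measurable F) {w₀ : M → ℝ} (hw₀m : Measurable w₀) (hw₀ : ∀ p, 0 ≤ w₀ p) (hw₀i : Integrable w₀ ν)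
    (hFbd : ∀ p (y : V), ‖y‖ ≤ R → |F (p, y)| ≤ C * w₀ p)
    (hfibre : ∀ p, |(∫ y in closedBall (0 : V) R, F (p, y)) -
        w₀ p * ((2 * π / β) ^ ((finrank ℝ V : ℝ) / 2) / Real.sqrt (LinearMap.det (A p)))| ≤
      ε * (w₀ p * ((2 * π / β) ^ ((finrank ℝ V : ℝ) / 2) / Real.sqrt (LinearMap.det (A p))))) :
    IntegrableOn F (univ ×ˢ closedBall (0 : V) R) (ν.prod volume) ∧
    Integrable (fun p => w₀ p / Real.sqrt (LinearMap.det (A p))) ν ∧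
    |(∫ z in univ ×ˢ closedBall (0 : V) R, F z ∂(ν.prod volume)) -
        (2 * π / β) ^ ((finrank ℝ V : ℝ) / 2) * ∫ p, w₀ p / Real.sqrt (LinearMap.det (A p)) ∂ν| ≤
      ε * ((2 * π / β) ^ ((finrank ℝ V : ℝ) / 2) * ∫ p, w₀ p / Real.sqrt (LinearMap.det (A p)) ∂ν) := by
  set B : Set V := closedBall (0 : V) R with hBdef
  have hBm : MeasurableSet B := measurableSet_closedBall
  set cpow : ℝ := (2 * π / β) ^ ((finrank ℝ V : ℝ) / 2) with hcpow
  have hcpow_pos : 0 < cpow := Real.rpow_pos_of_pos (by positivity) _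
  set 𝔊 : M → ℝ := fun p => cpow / Real.sqrt (LinearMap.det (A p)) with h𝔊
  -- integrability on the tube from the bound `|F| ≤ C w₀`
  haveI : IsFiniteMeasure ((volume : Measure V).restrict B) := by
    rw [hBdef]
    exact isFiniteMeasure_restrict.mpr measure_closedBall_lt_top.ne
  have hprod : (ν.prod volume).restrict ((univ : Set M) ×ˢ B) = ν.prod ((volume : Measure V).restrict B) := by
    rw [← Measure.prod_restrict, Measure.restrict_univ]
  have hdom : Integrable (fun z : M × V => (C * w₀ z.1) * (1 : ℝ)) (ν.prod ((volume : Measure V).restrict B)) :=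
    (hw₀i.const_mul C).mul_prod (integrable_const (1 : ℝ))
  have hFint : Integrable F (ν.prod ((volume : Measure V).restrict B)) := by
    refine hdom.mono hFm.aestronglyMeasurable ?_
    have hB_ae : ∀ᵐ z ∂(ν.prod ((volume : Measure V).restrict B)), z ∈ (univ : Set M) ×ˢ B := by
      rw [← hprod]
      exact ae_restrict_mem (MeasurableSet.univ.prod hBm)
    filter_upwards [hB_ae] with z hz
    have hyR : ‖z.2‖ ≤ R := by simpa [hBdef] using hz.2
    rw [Real.norm_eq_abs, Real.norm_eq_abs, mul_one, abs_of_nonneg (mul_nonneg hC (hw₀ z.1))]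
    exact hFbd z.1 z.2 hyR
  have hFon : IntegrableOn F ((univ : Set M) ×ˢ B) (ν.prod volume) := by
    rw [IntegrableOn, hprod]
    exact hFint
  -- Fubini
  have htube : ∫ z in (univ : Set M) ×ˢ B, F z ∂(ν.prod volume) = ∫ p, (∫ y in B, F (p, y)) ∂ν := by
    rw [hprod, integral_prod F hFint]
  have hIint : Integrable (fun p => ∫ y in B, F (p, y)) ν := hFint.integral_prod_left
  -- the main term
  obtain ⟨-, hGint, -⟩ := integral_gaussian_fibred hA hlam hcoer hAm hw₀m hw₀ hw₀i hβ
  have hmain_int : Integrable (fun p => w₀ p * 𝔊 p) ν := hGint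
  have hdet_int : Integrable (fun p => w₀ p / Real.sqrt (LinearMap.det (A p))) ν := by
    have h := hmain_int.const_mul cpow⁻¹
    refine h.congr (Eventually.of_forall fun p => ?_)
    dsimp only
    simp only [h𝔊]
    field_simp
  have hmain_val : ∫ p, w₀ p * 𝔊 p ∂ν = cpow * ∫ p, w₀ p / Real.sqrt (LinearMap.det (A p)) ∂ν := by
    rw [← integral_const_mul]
    refine integral_congr_ae (Eventually.of_forall fun p => ?_)
    dsimp only
    simp only [h𝔊]
    ring
  -- integrate the fibre bound
  have hdiff : |(∫ p, (∫ y in B, F (p, y)) ∂ν) - ∫ p, w₀ p * 𝔊 p ∂ν| ≤ ∫ p, ε * (w₀ p * 𝔊 p) ∂ν := by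
    rw [← integral_sub hIint hmain_int, ← Real.norm_eq_abs]
    refine norm_integral_le_of_norm_le (hmain_int.const_mul ε) (Eventually.of_forall fun p => ?_)
    rw [Real.norm_eq_abs]
    exact hfibre p
  refine ⟨hFon, hdet_int, ?_⟩
  rw [htube, ← hmain_val]
  calc |(∫ p, (∫ y in B, F (p, y)) ∂ν) - ∫ p, w₀ p * 𝔊 p ∂ν| ≤ ∫ p, ε * (w₀ p * 𝔊 p) ∂ν := hdiff
    _ = ε * ∫ p, w₀ p * 𝔊 p ∂ν := integral_const_mul _ _

/-! ## §2 The instance with the cubic core: order-3 fibre jets suffice -/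

/-- ★★★ **Quantitative Morse–Bott Laplace method from CUBIC fibre data** (`O(β^{−1/2})`): `(M,ν)` s-finite, `V` the `m`-dimensional transversal, `A p`
symmetric uniformly `λ`-coercive and jointly measurable; on the ball `‖y‖ ≤ R`, `f(p,y) = ½⟪A p y,y⟫ + ρ(p,y)`, `w(p,y) = w₀(p)(1 + η(p,y))` with
`|ρ| ≤ A₃‖y‖³`, `|η| ≤ D‖y‖` (jointly measurable `f, w, ρ, η`; NO parity), `0 ≤ w₀ ∈ L¹(ν)`, `A₃R ≤ λ/(8(m+8))`, `DR ≤ 1`.  Then for every `β > 0`: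
`|∫_{M×B̄_R} e^{−βf}w − (2π/β)^{m/2}∫ w₀/√det(A p) dν| ≤ (K₃/√β + 16(m+8)/(λR²β))·(main)`, `K₃ = 16A₃(m+8)/λ + 256A₃(m+8)²/λ² + D + 8D(m+8)/λ`.
[cite: Breitung1994, Thm 41 p. 56] [cite: HasenpflugRudolfSprungk2024, App. 4.1 Thm 16] -/
theorem laplaceMethod_quantitative_fibred_cubic {A : M → V →ₗ[ℝ] V} (hA : ∀ p, (A p).IsSymmetric) {lam : ℝ} (hlam : 0 < lam)
    (hcoer : ∀ p (y : V), lam * ‖y‖ ^ 2 ≤ ⟪A p y, y⟫_ℝ)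
    (hAm : Measurable fun z : M × V => ⟪A z.1 z.2, z.2⟫_ℝ)
    {R A₃ D β : ℝ} (hR : 0 < R) (hA₃ : 0 ≤ A₃) (hD : 0 ≤ D) (hβ : 0 < β)
    (hsmall : A₃ * R ≤ lam / (8 * ((finrank ℝ V : ℝ) + 8))) (hDR : D * R ≤ 1)
    {f w ρ η : M × V → ℝ} {w₀ : M → ℝ}
    (hfm : Measurable f) (hwm : Measurable w) (hρ_meas : Measurable ρ) (hη_meas : Measurable η)
    (hw₀m : Measurable w₀) (hw₀ : ∀ p, 0 ≤ w₀ p) (hw₀i : Integrable w₀ ν)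
    (hρ : ∀ p (y : V), ‖y‖ ≤ R → |ρ (p, y)| ≤ A₃ * ‖y‖ ^ 3) (hη : ∀ p (y : V), ‖y‖ ≤ R → |η (p, y)| ≤ D * ‖y‖)
    (hf : ∀ p (y : V), ‖y‖ ≤ R → f (p, y) = (1 / 2) * ⟪A p y, y⟫_ℝ + ρ (p, y))
    (hw : ∀ p (y : V), ‖y‖ ≤ R → w (p, y) = w₀ p * (1 + η (p, y))) :
    IntegrableOn (fun z : M × V => Real.exp (-(β * f z)) * w z) (univ ×ˢ closedBall (0 : V) R) (ν.prod volume) ∧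
    Integrable (fun p => w₀ p / Real.sqrt (LinearMap.det (A p))) ν ∧
    |(∫ z in univ ×ˢ closedBall (0 : V) R, Real.exp (-(β * f z)) * w z ∂(ν.prod volume)) -
        (2 * π / β) ^ ((finrank ℝ V : ℝ) / 2) * ∫ p, w₀ p / Real.sqrt (LinearMap.det (A p)) ∂ν| ≤
      ((16 * A₃ * ((finrank ℝ V : ℝ) + 8) / lam + 256 * A₃ * ((finrank ℝ V : ℝ) + 8) ^ 2 / lam ^ 2 + D + 8 * D * ((finrank ℝ V : ℝ) + 8) / lam) /
          Real.sqrt β + 16 * ((finrank ℝ V : ℝ) + 8) / (lam * R ^ 2) / β) *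
        ((2 * π / β) ^ ((finrank ℝ V : ℝ) / 2) * ∫ p, w₀ p / Real.sqrt (LinearMap.det (A p)) ∂ν) := by
  refine laplaceMethod_fibred_of_fibrewise (F := fun z => Real.exp (-(β * f z)) * w z) hA hlam hcoer hAm hβ (by norm_num : (0:ℝ) ≤ 2)
    (((hfm.const_mul β).neg.exp).mul hwm) hw₀m hw₀ hw₀i ?_ ?_
  · -- the bound `|e^{−βf} w| ≤ 2 w₀` on the ball
    intro p y hy
    have h2 := laplace_cubic_abs_integrand_le_two (A := A p) hlam (hcoer p) hA₃ hD hβ hsmall hDR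
      (fun y hy => hρ p y hy) (fun y hy => hη p y hy) y hy
    have hFy : Real.exp (-(β * f (p, y))) * w (p, y) =
        w₀ p * (Real.exp (-(β * (((1 / 2) * ⟪A p y, y⟫_ℝ) + ρ (p, y)))) * (1 + η (p, y))) := by
      rw [hf p y hy, hw p y hy]; ring
    rw [hFy, abs_mul, abs_of_nonneg (hw₀ p)]
    calc w₀ p * |Real.exp (-(β * (((1 / 2) * ⟪A p y, y⟫_ℝ) + ρ (p, y)))) * (1 + η (p, y))| ≤ w₀ p * 2 :=
        mul_le_mul_of_nonneg_left h2 (hw₀ p)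
      _ = 2 * w₀ p := by ring
  · -- the cubic core on each fibre
    intro p
    exact laplaceMethod_quantitative_cubic_of_eqOn (A := A p) (f := fun y => f (p, y)) (w := fun y => w (p, y))
      (ρ := fun y => ρ (p, y)) (η := fun y => η (p, y)) (hA p) hlam (hcoer p) hR hA₃ hD hβ (hw₀ p) hsmall hDR
      (hρ_meas.comp measurable_prodMk_left) (hη_meas.comp measurable_prodMk_left) (hρ p) (hη p) (hf p) (hw p)

end Summit.QuantumFields.YangMills.Theorems.QuantitativeLaplace

end
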